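import Summits.QuantumFields.YangMills.Theorems.BalabanUVNodesN12ForestSliceCurved
import HarnessLib

/-!
# BalabanUVNodes ∕ N12 — THE FOREST PROJECTION ONTO THE AXIAL SLICE WITH ITS `ℓ¹` LETTER: dag-n12-w3's twisted residual `ξ` along a rooted forest RE-DERIVED WITH ITS SIZE
# `‖ξ(x)‖ ≤ Σ_{s ∈ path x} ‖X(s)‖`, and the projection `X₀ ↦ X₀ − (Ad(U₀,b⁻¹)ξ(b₋) − ξ(b₊))` onto the fields vanishing on the path bonds with `‖·‖_{ℓ¹} ≤ (1 + 2·#bonds·Lp)·‖X₀‖_{ℓ¹}`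
# ([Balaban1985Variational] (4) p. 278, (16)–(18) p. 280, Sect. C (45)–(46) p. 285; [Balaban1985RegularSpaces] (1.19) p. 79)

Cell `pub-ymgap` (HUMAN RULINGS D-0062 ∕ D-0149), WIDTH SEAT `pub-ymgap-dag-n12-w6` g14 (node N12 = [B15]; key K1⁹ `stmt-QuantumFields-27364`, `--kind proof --supports … --as helper`;
count-neutral; bus 2026-08-29 DAGN12W6-G14 CLAIM-2, file A).  THEOREMS ONLY (0 `def`, 0 `instance`, 0 `sorry`).  CONSUMED BY NAME, nothing modified: dag-n12-w3 g3's
`N12ForestSliceCurved.exists_twisted_residual_of_forest` (the construction is repeated verbatim — a `foldl` down the path — because its size is needed), dag-n12-w2's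
`Node00.norm_coe_specialUnitaryAd` (the adjoint twist is an operator-norm isometry).

WHY.  The multiplier letter (M) of the (β)-split (`…N12MultiplierLetterOfSlicePreimage`, p710811) is reduced to a SLICE preimage of the curvature datum with an `ℓ¹` letter `B₁` that must be
chosen ONCE PER HEIGHT.  The lineage's lettered right inverses of `DΨ_{U₀}(0)` (p678596 ∕ p690553 ∕ p705019) are not slice-valued; dag-n12-w3 ∕ g11 make preimages slice-valued by subtracting
the orbit tangent of the twisted residual `ξ` (`N12ForestSliceOfProxies.exists_forest_preimage_of_surjective_proxies`), an EXISTENCE statement with no size.  THIS FILE supplies the size: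
the residual is a `foldl` of isometric twists and one subtraction per step, so `‖ξ(x)‖ ≤ Σ_{s ∈ path x}‖X(s.bond)‖ ≤ |path x|·‖X‖_{ℓ¹}`, and the projected field obeys
`Σ_b‖X_b‖ ≤ (1 + 2·#bonds·Lp)·Σ_b‖X₀,b‖` for forests with paths of length `≤ Lp` (the geodesic forest of record: `N12RootedForestGeodesic.exists_geodesicForest_Bj`, `Lp = d·(L^k − 1)∕2`).

CONTENTS (namespace `Summit.QuantumFields.YangMills.BalabanUVNodes.N12ForestProjectionL1Letter`).
* §1 `foldl_twistStep_size_le` (one induction), ★ `exists_twisted_residual_of_forest_norm_le` — the twisted residual WITH ITS SIZE, for any sub-additive size functional `nrm` invariant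
  under the twists (so both the Hilbert–Schmidt and the operator norm of `𝔰𝔲(N)`).
* §2 ★★ `exists_forestProjection_l1` — at a base field `U₀`: for every bond field `X₀ : bonds → 𝔰𝔲(N)` a site field `ξ` vanishing on the roots such that `X₀ − (Ad(U₀,b⁻¹)ξ(b₋) − ξ(b₊))`
  vanishes on every path bond, with the `ℓ¹(op)` letter `(1 + 2·#bonds·Lp)`; `sum_opNorm_orbitTangent_le` (the tangent's `ℓ¹` size `≤ 2·#bonds·Lp·‖X₀‖_{ℓ¹}`).

HONEST FRAMING.  Finite sums and one list induction; per-height (volume-dependent: `#bonds`, `Lp`) constants — print's volume-uniform (46) NOT claimed; nothing of Bałaban's asserted; N12 NOT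
discharged; K1⁹ NOT closed; counts of record unmoved (typed 28∕28 · discharged 8∕27); one finite 𝕋⁴ programme at fixed ε — R4 closes the conditional rung `BalabanLadder.UV` only; no summit
statement is proved here and NOT the Yang–Mills mass gap (Clay); nothing continuum ∕ ℝ⁴ ∕ OS.
-/

noncomputable section

namespace Summit.QuantumFields.YangMills.BalabanUVNodes.N12ForestProjectionL1Letter

open scoped BigOperators Matrix.Norms.L2Operator
open Literature.MathematicalPhysics.QuantumFieldTheory.Balaban1983to89
open T4Continuum
open T4AdjointCovarianceUnitary (lieSU specialUnitaryAd coe_specialUnitaryAd)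
open Node00

variable {P : Params} {j : ℕ}

/-! ## §1  The twisted residual along a rooted forest, with its size -/

section Residual

variable {V : Type*} [AddCommGroup V]

/-- The size of a `foldl` of twisted steps `v ↦ β_b⁻¹(α_b v − X_b)` ∕ `v ↦ α_b⁻¹(X_b + β_b v)` grows by at most `nrm X_b` per step, for any sub-additive size `nrm` invariant under the twists
(one list induction). [cite: Balaban1985Variational, (16)–(18) p.280 (bookkeeping)] -/
theorem foldl_twistStep_size_le (α β : PBond P j → V ≃+ V) (nrm : V → ℝ)
    (hsub : ∀ v w, nrm (v - w) ≤ nrm v + nrm w) (hadd : ∀ v w, nrm (v + w) ≤ nrm v + nrm w)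
    (hα : ∀ b v, nrm (α b v) = nrm v) (hβ : ∀ b v, nrm (β b v) = nrm v)
    (X : PBond P j → V) (l : List (LStep P j)) (v : V) :
    nrm (l.foldl (fun v s => if s.fwd then (β s.bond).symm (α s.bond v - X s.bond) else (α s.bond).symm (X s.bond + β s.bond v)) v)
      ≤ nrm v + (l.map fun s => nrm (X s.bond)).sum := by
  have hαs : ∀ b w, nrm ((α b).symm w) = nrm w := fun b w => by
    conv_rhs => rw [← (α b).apply_symm_apply w]
    rw [hα]
  have hβs : ∀ b w, nrm ((β b).symm w) = nrm w := fun b w => by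
    conv_rhs => rw [← (β b).apply_symm_apply w]
    rw [hβ]
  have hstep : ∀ (s : LStep P j) (w : V),
      nrm (if s.fwd then (β s.bond).symm (α s.bond w - X s.bond) else (α s.bond).symm (X s.bond + β s.bond w)) ≤ nrm w + nrm (X s.bond) := by
    intro s w
    cases s.fwd
    · simp only [Bool.false_eq_true, if_false]
      rw [hαs]
      calc nrm (X s.bond + β s.bond w) ≤ nrm (X s.bond) + nrm (β s.bond w) := hadd _ _
        _ = nrm w + nrm (X s.bond) := by rw [hβ, add_comm]
    · simp only [if_true]
      rw [hβs]
      calc nrm (α s.bond w - X s.bond) ≤ nrm (α s.bond w) + nrm (X s.bond) := hsub _ _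
        _ = nrm w + nrm (X s.bond) := by rw [hα]
  induction l generalizing v with
  | nil => simp
  | cons s l ih =>
      rw [List.foldl_cons, List.map_cons, List.sum_cons]
      refine (ih _).trans ?_
      have h := hstep s v
      linarith

/-- ★ **THE TWISTED RESIDUAL WITH ITS SIZE** — dag-n12-w3's `N12ForestSliceCurved.exists_twisted_residual_of_forest` (telescoping down a rooted forest with (F1): every bond field `X`
agrees on every path bond with the twisted gradient `α_b ξ(b₋) − β_b ξ(b₊)` of a site function `ξ` vanishing on the roots) re-derived together with the estimate
`nrm (ξ x) ≤ Σ_{s ∈ path x} nrm (X s.bond)` for any sub-additive size functional invariant under the twists. [cite: Balaban1985Variational, (4) p.278, (16)–(18) p.280; Balaban1985RegularSpaces, (1.19) p.79] -/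
theorem exists_twisted_residual_of_forest_norm_le {R : Set (Site P j)} {path : Site P j → List (LStep P j)} (hroot : ∀ r ∈ R, path r = [])
    (hF1 : ∀ x, ∀ s ∈ path x, ∃ x' x'' : Site P j, path x'' = path x' ++ [s] ∧
      (s.fwd = true → s.bond.src = x' ∧ s.bond.tgt = x'') ∧ (s.fwd = false → s.bond.src = x'' ∧ s.bond.tgt = x'))
    (α β : PBond P j → V ≃+ V) (nrm : V → ℝ) (hnrm0 : nrm 0 = 0)
    (hsub : ∀ v w, nrm (v - w) ≤ nrm v + nrm w) (hadd : ∀ v w, nrm (v + w) ≤ nrm v + nrm w)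
    (hα : ∀ b v, nrm (α b v) = nrm v) (hβ : ∀ b v, nrm (β b v) = nrm v) (X : PBond P j → V) :
    ∃ ξ : Site P j → V, (∀ r ∈ R, ξ r = 0) ∧ (∀ x, ∀ s ∈ path x, X s.bond = α s.bond (ξ s.bond.src) - β s.bond (ξ s.bond.tgt)) ∧
      ∀ x, nrm (ξ x) ≤ ((path x).map fun s => nrm (X s.bond)).sum := by
  refine ⟨fun x => (path x).foldl (fun v s => if s.fwd then (β s.bond).symm (α s.bond v - X s.bond) else (α s.bond).symm (X s.bond + β s.bond v)) 0,
    fun r hr => by simp [hroot r hr], ?_, fun x => ?_⟩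
  · intro x s hs
    obtain ⟨x', x'', hp, hfwd, hbwd⟩ := hF1 x s hs
    have hstep : (path x'').foldl (fun v s => if s.fwd then (β s.bond).symm (α s.bond v - X s.bond) else (α s.bond).symm (X s.bond + β s.bond v)) 0 =
        (if s.fwd then (β s.bond).symm (α s.bond ((path x').foldl (fun v s => if s.fwd then (β s.bond).symm (α s.bond v - X s.bond)
          else (α s.bond).symm (X s.bond + β s.bond v)) 0) - X s.bond)
        else (α s.bond).symm (X s.bond + β s.bond ((path x').foldl (fun v s => if s.fwd then (β s.bond).symm (α s.bond v - X s.bond)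
          else (α s.bond).symm (X s.bond + β s.bond v)) 0))) := by
      rw [hp, List.foldl_append, List.foldl_cons, List.foldl_nil]
    beta_reduce
    cases h : s.fwd
    · obtain ⟨hs, ht⟩ := hbwd h
      rw [hs, ht, hstep, h]
      simp only [Bool.false_eq_true, if_false, AddEquiv.apply_symm_apply, add_sub_cancel_right]
    · obtain ⟨hs, ht⟩ := hfwd h
      rw [hs, ht, hstep, h]
      simp only [if_true, AddEquiv.apply_symm_apply, sub_sub_cancel]
  · have h := foldl_twistStep_size_le α β nrm hsub hadd hα hβ X (path x) 0
    rw [hnrm0, zero_add] at h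
    exact h

end Residual

/-! ## §2  The forest projection onto the axial slice at a base field `U₀`, with its `ℓ¹(op)` letter -/

section Projection

variable {N : ℕ}

/-- The `ℓ¹(op)` size of the orbit tangent `b ↦ Ad(U₀,b⁻¹)ξ(b₋) − ξ(b₊)` of a site field with `‖↑ξ(x)‖ ≤ Lp·M` everywhere is `≤ 2·#bonds·Lp·M`. [cite: Balaban1985Variational, (4) p.278, (45)–(46) p.285 (bookkeeping)] -/
theorem sum_opNorm_orbitTangent_le (U₀ : GaugeField P j (SU N)) (ξ : Site P j → lieSU (Fin N)) {C : ℝ} (hξ : ∀ x, ‖(ξ x : Matrix (Fin N) (Fin N) ℂ)‖ ≤ C) :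
    ∑ b : PBond P j, ‖((specialUnitaryAd (U₀ b)⁻¹ (ξ b.src) - ξ b.tgt : lieSU (Fin N)) : Matrix (Fin N) (Fin N) ℂ)‖ ≤ 2 * (Fintype.card (PBond P j)) * C := by
  have hb : ∀ b : PBond P j, ‖((specialUnitaryAd (U₀ b)⁻¹ (ξ b.src) - ξ b.tgt : lieSU (Fin N)) : Matrix (Fin N) (Fin N) ℂ)‖ ≤ 2 * C := fun b => by
    rw [AddSubgroupClass.coe_sub]
    refine (norm_sub_le _ _).trans ?_
    rw [norm_coe_specialUnitaryAd]
    have h1 := hξ b.src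
    have h2 := hξ b.tgt
    linarith
  calc ∑ b : PBond P j, ‖((specialUnitaryAd (U₀ b)⁻¹ (ξ b.src) - ξ b.tgt : lieSU (Fin N)) : Matrix (Fin N) (Fin N) ℂ)‖
      ≤ ∑ _b : PBond P j, 2 * C := Finset.sum_le_sum fun b _ => hb b
    _ = 2 * (Fintype.card (PBond P j)) * C := by rw [Finset.sum_const, Finset.card_univ, nsmul_eq_mul]; ring

/-- ★★ **THE FOREST PROJECTION ONTO THE AXIAL SLICE, WITH ITS `ℓ¹(op)` LETTER**: at a base field `U₀`, for a rooted forest (roots `R` with empty paths, (F1), paths of length `≤ Lp`) and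
EVERY bond field `X₀ : bonds → 𝔰𝔲(N)`, there is a site field `ξ` vanishing on `R` such that the projected field `X₀ − (Ad(U₀,b⁻¹)ξ(b₋) − ξ(b₊))` vanishes on every path bond (the axial slice
(F3)) and `Σ_b‖X₀,b − (Ad(U₀,b⁻¹)ξ(b₋) − ξ(b₊))‖_op ≤ (1 + 2·#bonds·Lp)·Σ_b‖X₀,b‖_op` — §1 with `α_b = Ad(U₀,b⁻¹)` (an operator-norm isometry, `Node00.norm_coe_specialUnitaryAd`), `β = id`,
`‖↑ξ(x)‖ ≤ |path x|·‖X₀‖_{ℓ¹}`.  The orbit tangent is killed by `DΨ_{U₀}(0)` (dag-n12-w3 ∕ g11), so images are unchanged — not restated here.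
[cite: Balaban1985Variational, (4) p.278, (16)–(18) p.280, Sect. C (45)–(46) p.285; Balaban1985RegularSpaces, (1.19) p.79] -/
theorem exists_forestProjection_l1 (U₀ : GaugeField P j (SU N)) {R : Set (Site P j)} {path : Site P j → List (LStep P j)} (hroot : ∀ r ∈ R, path r = [])
    (hF1 : ∀ x, ∀ s ∈ path x, ∃ x' x'' : Site P j, path x'' = path x' ++ [s] ∧
      (s.fwd = true → s.bond.src = x' ∧ s.bond.tgt = x'') ∧ (s.fwd = false → s.bond.src = x'' ∧ s.bond.tgt = x'))
    {Lp : ℕ} (hlen : ∀ x, (path x).length ≤ Lp) (X₀ : PBond P j → lieSU (Fin N)) :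
    ∃ ξ : Site P j → lieSU (Fin N), (∀ r ∈ R, ξ r = 0) ∧
      (∀ x, ∀ s ∈ path x, X₀ s.bond - (specialUnitaryAd (U₀ s.bond)⁻¹ (ξ s.bond.src) - ξ s.bond.tgt) = 0) ∧
      (∀ x, ‖(ξ x : Matrix (Fin N) (Fin N) ℂ)‖ ≤ Lp * ∑ b : PBond P j, ‖(X₀ b : Matrix (Fin N) (Fin N) ℂ)‖) ∧
      ∑ b : PBond P j, ‖((X₀ b - (specialUnitaryAd (U₀ b)⁻¹ (ξ b.src) - ξ b.tgt) : lieSU (Fin N)) : Matrix (Fin N) (Fin N) ℂ)‖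
        ≤ (1 + 2 * (Fintype.card (PBond P j)) * Lp) * ∑ b : PBond P j, ‖(X₀ b : Matrix (Fin N) (Fin N) ℂ)‖ := by
  -- §1 with `α_b = Ad(U₀,b⁻¹)`, `β = id`, size = operator norm of the matrix
  obtain ⟨ξ, hξR, hres, hsize⟩ := exists_twisted_residual_of_forest_norm_le hroot hF1
    (fun b => (specialUnitaryAd (U₀ b)⁻¹).toLinearEquiv.toAddEquiv) (fun _ => AddEquiv.refl _)
    (fun v : lieSU (Fin N) => ‖(v : Matrix (Fin N) (Fin N) ℂ)‖) (by simp)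
    (fun v w => by rw [AddSubgroupClass.coe_sub]; exact norm_sub_le _ _) (fun v w => by rw [AddMemClass.coe_add]; exact norm_add_le _ _)
    (fun b v => norm_coe_specialUnitaryAd _ _) (fun _ _ => rfl) X₀
  set M : ℝ := ∑ b : PBond P j, ‖(X₀ b : Matrix (Fin N) (Fin N) ℂ)‖ with hM
  have hM0 : 0 ≤ M := Finset.sum_nonneg fun b _ => norm_nonneg _
  have hterm : ∀ b : PBond P j, ‖(X₀ b : Matrix (Fin N) (Fin N) ℂ)‖ ≤ M := fun b =>
    Finset.single_le_sum (f := fun b' : PBond P j => ‖(X₀ b' : Matrix (Fin N) (Fin N) ℂ)‖) (fun _ _ => norm_nonneg _) (Finset.mem_univ b)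
  have hξb : ∀ x, ‖(ξ x : Matrix (Fin N) (Fin N) ℂ)‖ ≤ Lp * M := fun x => by
    refine (hsize x).trans ?_
    have h1 : ((path x).map fun s => ‖(X₀ s.bond : Matrix (Fin N) (Fin N) ℂ)‖).sum ≤ (path x).length • M := by
      have h := List.sum_le_card_nsmul ((path x).map fun s => ‖(X₀ s.bond : Matrix (Fin N) (Fin N) ℂ)‖) M (fun r hr => by
        obtain ⟨s, _, rfl⟩ := List.mem_map.1 hr
        exact hterm s.bond)
      simpa only [List.length_map] using h
    rw [nsmul_eq_mul] at h1
    refine h1.trans ?_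
    exact mul_le_mul_of_nonneg_right (by exact_mod_cast hlen x) hM0
  refine ⟨ξ, hξR, fun x s hs => ?_, hξb, ?_⟩
  · rw [sub_eq_zero]
    exact hres x s hs
  · have htan := sum_opNorm_orbitTangent_le U₀ ξ hξb
    calc ∑ b : PBond P j, ‖((X₀ b - (specialUnitaryAd (U₀ b)⁻¹ (ξ b.src) - ξ b.tgt) : lieSU (Fin N)) : Matrix (Fin N) (Fin N) ℂ)‖
        ≤ ∑ b : PBond P j, (‖(X₀ b : Matrix (Fin N) (Fin N) ℂ)‖ + ‖((specialUnitaryAd (U₀ b)⁻¹ (ξ b.src) - ξ b.tgt : lieSU (Fin N)) : Matrix (Fin N) (Fin N) ℂ)‖) :=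
          Finset.sum_le_sum fun b _ => by rw [AddSubgroupClass.coe_sub]; exact norm_sub_le _ _
      _ = M + ∑ b : PBond P j, ‖((specialUnitaryAd (U₀ b)⁻¹ (ξ b.src) - ξ b.tgt : lieSU (Fin N)) : Matrix (Fin N) (Fin N) ℂ)‖ := by
          rw [Finset.sum_add_distrib]
      _ ≤ M + 2 * (Fintype.card (PBond P j)) * (Lp * M) := by linarith
      _ = (1 + 2 * (Fintype.card (PBond P j)) * Lp) * M := by ring

end Projection

end Summit.QuantumFields.YangMills.BalabanUVNodes.N12ForestProjectionL1Letter

end
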